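import Summits.Ventures.LatticeQCDFlow.Scaling.DoeblinHotFreshness
import Summits.Ventures.LatticeQCDFlow.Scaling.DominatedStarMinorization

/-!
HONEST FRAMING: exact (Metropolis-corrected) sampling algorithms for lattice gauge theory; figures
of merit are autocorrelation/cost numbers at stated couplings and volumes; no continuum-physics
claim.

# DoeblinHotMinorization — WITH A PARTLY REFRESHED HUB THE LAW ON THE EMPTY STALE SET IS STILL `P(D_n = ∅)·π̃`, SO
# `(λ₀Pⁿ)(z) ≥ (ν₀Qⁿ)(∅)·π̃(z)` AND `‖λ₀Pⁿ − π̃‖_TV ≤ Σ_{D≠∅}(ν₀Qⁿ)(D)` FROM EVERY FRESH INITIAL LAW, WITH `Q` THE TAG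
# CHAIN OF HOT WEIGHT `w_E` (lean-2 GEN-27, ours)

Venture-side (OURS).  Cell `lqcd-flow` (pub-lqcd), unit `pub-lqcd-lean-2-g27`, 2026-08-27.  Doeblin-minorised hot
samplers, file 3.  Setting of `Scaling/DoeblinHotFreshness` (scheme `P = t·GSw + (1−t)·(w_E·Ẽ_0 + Π_w^M)`: exact
refresh of weight `w_E`, `μ_k`-stationary moves `M_k` of weights `w_k` at every level, `w_E + Σ_k w_k = 1`; one-sided
dominations `p·μ_{l_r}(φ_r u) ≤ μ_0(u)`, `q·μ_0(u) ≤ μ_{l_r}(φ_r u)`; fresh initial augmented law `Λ₀` with marginals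
`λ₀ = Σ_D Λ₀(·, D)`, `ν₀ = Σ_z Λ₀(z, ·)`).

## What is proved

* **`dob_lawAt_empty_eq_of`** — `Λ_n(z, ∅) = (ν₀Qⁿ)(∅)·π̃(z)`; **`dob_minorization_of`** —
  `(λ₀Pⁿ)(z) ≥ (ν₀Qⁿ)(∅)·π̃(z)` (`Λ₀ ≥ 0`; the dominations enter through `0 ≤ γ_r ≤ α_r`);
  **`dob_tvDist_le_stale_of`** — `‖λ₀Pⁿ − π̃‖_TV ≤ Σ_{D ≠ ∅}(ν₀Qⁿ)(D)`.

Reading (no numerics implied): the distance to equilibrium of the map-assisted hub with ANY stationary hot sampler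
that refreshes with weight `w_E` is at most the probability that chapter M's conservative stale set — run with hot
weight `w_E` — is non-empty; `Scaling/RegenerationTagDecay` ∕ `Scaling/WarmStartAugmentation` bound that probability and
the sequel `Scaling/DoeblinHotMixingCeiling` states the ceilings.  Literature grade (cell rule): OWN CONSTRUCTION;
nothing cited as a fact; no new bib keys.
-/

noncomputable section

open Finset Function
open Literature.Probability.MarkovChains

namespace Summit.Ventures.LatticeQCDFlow.Scaling

variable {S : Type*} [Fintype S] [DecidableEq S] {K m : ℕ} {μ : Fin (K + 1) → S → ℝ} {M E : Fin (K + 1) → S → S → ℝ}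
  {w : Fin (K + 1) → ℝ} {t wE p q : ℝ}

section Minor
variable (κ : Fin m → Fin K) (φ : Fin m → Equiv.Perm S)

/-- **ON THE EMPTY STALE SET: `Λ_n(z, ∅) = (ν₀Qⁿ)(∅)·π̃(z)`** (fresh initial law; exact refresh of weight `w_E`,
stationary moves at every level). [ours] -/
theorem dob_lawAt_empty_eq_of (hμ : ∀ k x, 0 < μ k x) (hμ1 : ∀ k, ∑ u, μ k u = 1) (hM : ∀ k, IsRowStochastic (M k))
    (hE : ∀ k u v, E k u v = μ k v) (hstat : ∀ (k : Fin (K + 1)) (v : S), ∑ u, μ k u * M k u v = μ k v)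
    (hw1 : wE + ∑ k, w k = 1)
    {α : Fin m → (Fin (K + 1) → S) → ℝ}
    (hα : ∀ r z, α r z = min 1 (tensorFun μ (edgeFlowSwap (φ r) 0 (κ r).succ z) / tensorFun μ z))
    {β : Fin m → (Fin (K + 1) → S) → ℝ} (hβ : ∀ r z, β r z = p * μ (κ r).succ (φ r (z 0)) / μ 0 (z 0))
    {β' : Fin m → (Fin (K + 1) → S) → ℝ}
    (hβ' : ∀ r z, β' r z = q * μ 0 ((φ r).symm (z (κ r).succ)) / μ (κ r).succ (z (κ r).succ))
    {γ : Fin m → (Fin (K + 1) → S) × Finset (Fin (K + 1)) → ℝ}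
    (hγ : ∀ r a, γ r a = if (0 : Fin (K + 1)) ∉ a.2 then (if (κ r).succ ∉ a.2 then α r a.1 else β r a.1)
      else (if (κ r).succ ∉ a.2 then β' r a.1 else 0))
    {gbar : Fin m → Finset (Fin (K + 1)) → ℝ}
    (hg : ∀ r D, gbar r D = if (0 : Fin (K + 1)) ∉ D then (if (κ r).succ ∉ D then (1 : ℝ) else p)
      else (if (κ r).succ ∉ D then q else 0))
    {Bset : Fin m → Finset (Fin (K + 1)) → Finset (Fin (K + 1))}
    (hB : ∀ r D, Bset r D = if (0 : Fin (K + 1)) ∉ D ∧ (κ r).succ ∉ D then D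
      else insert (0 : Fin (K + 1)) (insert (κ r).succ D))
    {Ph : (Fin (K + 1) → S) × Finset (Fin (K + 1)) → (Fin (K + 1) → S) × Finset (Fin (K + 1)) → ℝ}
    (hPh : ∀ a b, Ph a b = ∑ r : Fin m, t / m *
        (γ r a * (if b.1 = edgeFlowSwap (φ r) 0 (κ r).succ a.1 ∧ b.2 = a.2.image (Equiv.swap (0 : Fin (K + 1)) (κ r).succ)
            then (1 : ℝ) else 0)
          + (α r a.1 - γ r a) * (if b.1 = edgeFlowSwap (φ r) 0 (κ r).succ a.1 ∧ b.2 = Bset r a.2 then (1 : ℝ) else 0)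
          + (1 - α r a.1) * (if b.1 = a.1 ∧ b.2 = Bset r a.2 then (1 : ℝ) else 0))
      + (1 - t) * (wE * (coordKernel E 0 a.1 b.1 * (if b.2 = a.2.erase 0 then (1 : ℝ) else 0))
          + ∑ k : Fin (K + 1), w k * (coordKernel M k a.1 b.1 * (if b.2 = a.2 then (1 : ℝ) else 0))))
    {Q : Finset (Fin (K + 1)) → Finset (Fin (K + 1)) → ℝ}
    (hQ : ∀ D D', Q D D' = ∑ r : Fin m, t / m *
        (gbar r D * (if D' = D.image (Equiv.swap (0 : Fin (K + 1)) (κ r).succ) then (1 : ℝ) else 0)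
          + (1 - gbar r D) * (if D' = Bset r D then (1 : ℝ) else 0))
      + (1 - t) * (wE * (if D' = D.erase 0 then (1 : ℝ) else 0) + (1 - wE) * (if D' = D then (1 : ℝ) else 0)))
    {Λ₀ : (Fin (K + 1) → S) × Finset (Fin (K + 1)) → ℝ}
    (hfresh : ∀ (z : Fin (K + 1) → S) (D : Finset (Fin (K + 1))) (j : Fin (K + 1)) (v : S), j ∉ D →
      Λ₀ (update z j v, D) * μ j (z j) = Λ₀ (z, D) * μ j v)
    (n : ℕ) (z : Fin (K + 1) → S) :
    lawAt Ph Λ₀ n (z, ∅) = lawAt Q (fun D' => ∑ z : Fin (K + 1) → S, Λ₀ (z, D')) n ∅ * tensorFun μ z := by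
  have hprop := fresh_empty_proportional_prod hμ (dob_fresh_lawAt_of κ φ hμ hE hstat hα hβ hβ' hγ hB hPh hfresh n)
  have hπ1 : ∑ z', tensorFun μ z' = 1 := sum_tensorFun_eq_one _ hμ1
  have hsum : lawAt Ph Λ₀ n (z, ∅) * ∑ z', tensorFun μ z' = (∑ z', lawAt Ph Λ₀ n (z', ∅)) * tensorFun μ z := by
    rw [Finset.mul_sum, Finset.sum_mul]
    exact sum_congr rfl fun z' _ => hprop z z'
  rw [hπ1, mul_one, dob_lawAt_snd_of κ φ hμ hμ1 hM hE hstat hw1 hα hβ hβ' hγ hg hB hPh hQ hfresh n ∅] at hsum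
  exact hsum

/-- **MINORISATION FROM A FRESH, NON-NEGATIVE INITIAL LAW: `(λ₀Pⁿ)(z) ≥ (ν₀Qⁿ)(∅)·π̃(z)`** for the scheme with a partly
refreshed hub under the two one-sided dominations (`0 ≤ p, q`). [ours] -/
theorem dob_minorization_of (hm : 1 ≤ m) (ht0 : 0 ≤ t) (ht1 : t ≤ 1) (hwE0 : 0 ≤ wE) (hw0 : ∀ k, 0 ≤ w k)
    (hw1 : wE + ∑ k, w k = 1) (hμ : ∀ k x, 0 < μ k x) (hμ1 : ∀ k, ∑ u, μ k u = 1) (hM : ∀ k, IsRowStochastic (M k))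
    (hE : ∀ k u v, E k u v = μ k v) (hstat : ∀ (k : Fin (K + 1)) (v : S), ∑ u, μ k u * M k u v = μ k v)
    (hp0 : 0 ≤ p) (hq0 : 0 ≤ q) (hdom : ∀ r u, p * μ (κ r).succ (φ r u) ≤ μ 0 u)
    (hrev : ∀ r u, q * μ 0 u ≤ μ (κ r).succ (φ r u))
    {α : Fin m → (Fin (K + 1) → S) → ℝ}
    (hα : ∀ r z, α r z = min 1 (tensorFun μ (edgeFlowSwap (φ r) 0 (κ r).succ z) / tensorFun μ z))
    {β : Fin m → (Fin (K + 1) → S) → ℝ} (hβ : ∀ r z, β r z = p * μ (κ r).succ (φ r (z 0)) / μ 0 (z 0))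
    {β' : Fin m → (Fin (K + 1) → S) → ℝ}
    (hβ' : ∀ r z, β' r z = q * μ 0 ((φ r).symm (z (κ r).succ)) / μ (κ r).succ (z (κ r).succ))
    {γ : Fin m → (Fin (K + 1) → S) × Finset (Fin (K + 1)) → ℝ}
    (hγ : ∀ r a, γ r a = if (0 : Fin (K + 1)) ∉ a.2 then (if (κ r).succ ∉ a.2 then α r a.1 else β r a.1)
      else (if (κ r).succ ∉ a.2 then β' r a.1 else 0))
    {gbar : Fin m → Finset (Fin (K + 1)) → ℝ}
    (hg : ∀ r D, gbar r D = if (0 : Fin (K + 1)) ∉ D then (if (κ r).succ ∉ D then (1 : ℝ) else p)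
      else (if (κ r).succ ∉ D then q else 0))
    {Bset : Fin m → Finset (Fin (K + 1)) → Finset (Fin (K + 1))}
    (hB : ∀ r D, Bset r D = if (0 : Fin (K + 1)) ∉ D ∧ (κ r).succ ∉ D then D
      else insert (0 : Fin (K + 1)) (insert (κ r).succ D))
    {Ph : (Fin (K + 1) → S) × Finset (Fin (K + 1)) → (Fin (K + 1) → S) × Finset (Fin (K + 1)) → ℝ}
    (hPh : ∀ a b, Ph a b = ∑ r : Fin m, t / m *
        (γ r a * (if b.1 = edgeFlowSwap (φ r) 0 (κ r).succ a.1 ∧ b.2 = a.2.image (Equiv.swap (0 : Fin (K + 1)) (κ r).succ)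
            then (1 : ℝ) else 0)
          + (α r a.1 - γ r a) * (if b.1 = edgeFlowSwap (φ r) 0 (κ r).succ a.1 ∧ b.2 = Bset r a.2 then (1 : ℝ) else 0)
          + (1 - α r a.1) * (if b.1 = a.1 ∧ b.2 = Bset r a.2 then (1 : ℝ) else 0))
      + (1 - t) * (wE * (coordKernel E 0 a.1 b.1 * (if b.2 = a.2.erase 0 then (1 : ℝ) else 0))
          + ∑ k : Fin (K + 1), w k * (coordKernel M k a.1 b.1 * (if b.2 = a.2 then (1 : ℝ) else 0))))
    {Q : Finset (Fin (K + 1)) → Finset (Fin (K + 1)) → ℝ}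
    (hQ : ∀ D D', Q D D' = ∑ r : Fin m, t / m *
        (gbar r D * (if D' = D.image (Equiv.swap (0 : Fin (K + 1)) (κ r).succ) then (1 : ℝ) else 0)
          + (1 - gbar r D) * (if D' = Bset r D then (1 : ℝ) else 0))
      + (1 - t) * (wE * (if D' = D.erase 0 then (1 : ℝ) else 0) + (1 - wE) * (if D' = D then (1 : ℝ) else 0)))
    {Λ₀ : (Fin (K + 1) → S) × Finset (Fin (K + 1)) → ℝ}
    (hfresh : ∀ (z : Fin (K + 1) → S) (D : Finset (Fin (K + 1))) (j : Fin (K + 1)) (v : S), j ∉ D →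
      Λ₀ (update z j v, D) * μ j (z j) = Λ₀ (z, D) * μ j v)
    (hΛ0 : ∀ a, 0 ≤ Λ₀ a) (n : ℕ) (z : Fin (K + 1) → S) :
    lawAt Q (fun D' => ∑ z : Fin (K + 1) → S, Λ₀ (z, D')) n ∅ * tensorFun μ z
      ≤ lawAt (fun y z : Fin (K + 1) → S =>
          t * ptGraphSwap μ (fun r : Fin m => (((0 : Fin (K + 1)), (κ r).succ) : Fin (K + 1) × Fin (K + 1))) φ y z
          + (1 - t) * (wE * coordKernel E 0 y z + prodKernel w M y z)) (fun z => ∑ D, Λ₀ (z, D)) n z := by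
  rw [← dob_lawAt_fst_of κ φ hm hμ hα hPh Λ₀ n z,
    ← dob_lawAt_empty_eq_of κ φ hμ hμ1 hM hE hstat hw1 hα hβ hβ' hγ hg hB hPh hQ hfresh n z]
  have hγα := goodWeight_le_accept κ φ hμ hp0 hq0 hα hβ hβ' hγ hdom hrev
  have hnn : ∀ b, 0 ≤ lawAt Ph Λ₀ n b := fun b =>
    lawAt_nonneg (dob_aug_isRowStochastic κ φ hm ht0 ht1 hwE0 hw0 hw1 hM hμ hμ1 hE hα hγα hPh) hΛ0 n b
  exact Finset.single_le_sum (f := fun D => lawAt Ph Λ₀ n (z, D)) (fun D _ => hnn (z, D)) (mem_univ ∅)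

/-- **THE FRESHNESS BOUND FROM A FRESH INITIAL LAW: `‖λ₀Pⁿ − π̃‖_TV ≤ Σ_{D≠∅}(ν₀Qⁿ)(D)`** for the scheme with a partly
refreshed hub (`Λ₀ ≥ 0`, `Σ Λ₀ = 1`, `0 ≤ w_E ≤ 1`, `0 ≤ p, q ≤ 1`). [ours] -/
theorem dob_tvDist_le_stale_of (hm : 1 ≤ m) (ht0 : 0 ≤ t) (ht1 : t ≤ 1) (hwE0 : 0 ≤ wE) (hw0 : ∀ k, 0 ≤ w k)
    (hw1 : wE + ∑ k, w k = 1) (hμ : ∀ k x, 0 < μ k x) (hμ1 : ∀ k, ∑ u, μ k u = 1) (hM : ∀ k, IsRowStochastic (M k))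
    (hE : ∀ k u v, E k u v = μ k v) (hstat : ∀ (k : Fin (K + 1)) (v : S), ∑ u, μ k u * M k u v = μ k v)
    (hp0 : 0 ≤ p) (hp1 : p ≤ 1) (hq0 : 0 ≤ q) (hq1 : q ≤ 1) (hdom : ∀ r u, p * μ (κ r).succ (φ r u) ≤ μ 0 u)
    (hrev : ∀ r u, q * μ 0 u ≤ μ (κ r).succ (φ r u))
    {α : Fin m → (Fin (K + 1) → S) → ℝ}
    (hα : ∀ r z, α r z = min 1 (tensorFun μ (edgeFlowSwap (φ r) 0 (κ r).succ z) / tensorFun μ z))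
    {β : Fin m → (Fin (K + 1) → S) → ℝ} (hβ : ∀ r z, β r z = p * μ (κ r).succ (φ r (z 0)) / μ 0 (z 0))
    {β' : Fin m → (Fin (K + 1) → S) → ℝ}
    (hβ' : ∀ r z, β' r z = q * μ 0 ((φ r).symm (z (κ r).succ)) / μ (κ r).succ (z (κ r).succ))
    {γ : Fin m → (Fin (K + 1) → S) × Finset (Fin (K + 1)) → ℝ}
    (hγ : ∀ r a, γ r a = if (0 : Fin (K + 1)) ∉ a.2 then (if (κ r).succ ∉ a.2 then α r a.1 else β r a.1)
      else (if (κ r).succ ∉ a.2 then β' r a.1 else 0))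
    {gbar : Fin m → Finset (Fin (K + 1)) → ℝ}
    (hg : ∀ r D, gbar r D = if (0 : Fin (K + 1)) ∉ D then (if (κ r).succ ∉ D then (1 : ℝ) else p)
      else (if (κ r).succ ∉ D then q else 0))
    {Bset : Fin m → Finset (Fin (K + 1)) → Finset (Fin (K + 1))}
    (hB : ∀ r D, Bset r D = if (0 : Fin (K + 1)) ∉ D ∧ (κ r).succ ∉ D then D
      else insert (0 : Fin (K + 1)) (insert (κ r).succ D))
    {Ph : (Fin (K + 1) → S) × Finset (Fin (K + 1)) → (Fin (K + 1) → S) × Finset (Fin (K + 1)) → ℝ}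
    (hPh : ∀ a b, Ph a b = ∑ r : Fin m, t / m *
        (γ r a * (if b.1 = edgeFlowSwap (φ r) 0 (κ r).succ a.1 ∧ b.2 = a.2.image (Equiv.swap (0 : Fin (K + 1)) (κ r).succ)
            then (1 : ℝ) else 0)
          + (α r a.1 - γ r a) * (if b.1 = edgeFlowSwap (φ r) 0 (κ r).succ a.1 ∧ b.2 = Bset r a.2 then (1 : ℝ) else 0)
          + (1 - α r a.1) * (if b.1 = a.1 ∧ b.2 = Bset r a.2 then (1 : ℝ) else 0))
      + (1 - t) * (wE * (coordKernel E 0 a.1 b.1 * (if b.2 = a.2.erase 0 then (1 : ℝ) else 0))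
          + ∑ k : Fin (K + 1), w k * (coordKernel M k a.1 b.1 * (if b.2 = a.2 then (1 : ℝ) else 0))))
    {Q : Finset (Fin (K + 1)) → Finset (Fin (K + 1)) → ℝ}
    (hQ : ∀ D D', Q D D' = ∑ r : Fin m, t / m *
        (gbar r D * (if D' = D.image (Equiv.swap (0 : Fin (K + 1)) (κ r).succ) then (1 : ℝ) else 0)
          + (1 - gbar r D) * (if D' = Bset r D then (1 : ℝ) else 0))
      + (1 - t) * (wE * (if D' = D.erase 0 then (1 : ℝ) else 0) + (1 - wE) * (if D' = D then (1 : ℝ) else 0)))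
    {Λ₀ : (Fin (K + 1) → S) × Finset (Fin (K + 1)) → ℝ}
    (hfresh : ∀ (z : Fin (K + 1) → S) (D : Finset (Fin (K + 1))) (j : Fin (K + 1)) (v : S), j ∉ D →
      Λ₀ (update z j v, D) * μ j (z j) = Λ₀ (z, D) * μ j v)
    (hΛ0 : ∀ a, 0 ≤ Λ₀ a) (hΛ1 : ∑ a, Λ₀ a = 1) (n : ℕ) :
    tvDist (lawAt (fun y z : Fin (K + 1) → S =>
          t * ptGraphSwap μ (fun r : Fin m => (((0 : Fin (K + 1)), (κ r).succ) : Fin (K + 1) × Fin (K + 1))) φ y z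
          + (1 - t) * (wE * coordKernel E 0 y z + prodKernel w M y z)) (fun z => ∑ D, Λ₀ (z, D)) n) (tensorFun μ)
      ≤ ∑ D ∈ univ.filter (fun D : Finset (Fin (K + 1)) => D ≠ ∅),
          lawAt Q (fun D' => ∑ z : Fin (K + 1) → S, Λ₀ (z, D')) n D := by
  have hP := dob_scheme_isRowStochastic κ φ ht0 ht1 hwE0 hw0 hw1 hM hμ hμ1 hE
  have hwE1 : wE ≤ 1 := by
    have h := sum_nonneg fun k (_ : k ∈ (univ : Finset (Fin (K + 1)))) => hw0 k
    linarith
  have hQst := regen_isRowStochastic κ hm ht0 ht1 hwE0 hwE1 hp0 hp1 hq0 hq1 hg hQ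
  have hν1 : ∑ D, ∑ z : Fin (K + 1) → S, Λ₀ (z, D) = 1 := by rw [← hΛ1, Fintype.sum_prod_type_right]
  have hlam1 : ∑ z : Fin (K + 1) → S, ∑ D, Λ₀ (z, D) = 1 := by rw [← hΛ1, Fintype.sum_prod_type]
  have hmassQ : ∑ D, lawAt Q (fun D' => ∑ z : Fin (K + 1) → S, Λ₀ (z, D')) n D = 1 := by
    rw [sum_lawAt hQst]; exact hν1
  have hsplit := Finset.sum_filter_add_sum_filter_not univ (fun D : Finset (Fin (K + 1)) => D ≠ ∅)
    (fun D => lawAt Q (fun D' => ∑ z : Fin (K + 1) → S, Λ₀ (z, D')) n D)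
  have hEq : univ.filter (fun D : Finset (Fin (K + 1)) => ¬D ≠ ∅) = {∅} := by
    ext D; simp only [Finset.mem_filter, Finset.mem_univ, true_and, not_not, Finset.mem_singleton]
  rw [hmassQ, hEq, Finset.sum_singleton] at hsplit
  have htv := tvDist_le_of_pointwise_ge (fun z => (tensorFun_pos hμ z).le) (sum_tensorFun_eq_one _ hμ1)
    (by rw [sum_lawAt hP]; exact hlam1)
    (fun z => dob_minorization_of κ φ hm ht0 ht1 hwE0 hw0 hw1 hμ hμ1 hM hE hstat hp0 hq0 hdom hrev hα hβ hβ' hγ hg hB hPh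
      hQ hfresh hΛ0 n z)
  linarith

end Minor

end Summit.Ventures.LatticeQCDFlow.Scaling

end
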